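import Literature.AlgebraicGeometry.Resolution.AlterationsSemiStableResolution
import Literature.AlgebraicGeometry.Resolution.SmoothUniformizationProofs
import Literature.AlgebraicGeometry.Resolution.RegularLocusOpen
import HarnessLib

/-!
# De Jong's alteration theorem: Lemma 3.2 as printed, and the first sentence of 4.24 from it

Topic: `Literature/AlgebraicGeometry/Resolution`. Companion to `AlterationsSemiStableResolution.lean`,
which vendors the first sentence of de Jong 1996, 4.24 — "Using the modification of Lemma 3.2 we
reduce to the situation 4.23, where we have in addition that `codim(Sing(X), X) ≥ 3`. (Of course
the sections `τᵢ` still map into the smooth locus of `f` …)" — as ONE named fact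
`DeJong1996SemiStableCodimThree`, which bundles Lemma 3.2 with the bookkeeping of 4.24 (the
lifted sections `τ₁ᵢ`, Situation 4.23 for the new pair, the boundary `φ⁻¹(Z)`). This file
separates the two:

* `DeJong1996Lemma32` — NAMED FACT, **Lemma 3.2 as printed** (p. 62), for the curve
  `f : X → Y` of Situation 4.23 (`Y` a nonsingular projective variety: an excellent regular
  scheme): "There exists a projective modification `φ₁ : X₁ → X` with the following
  properties: (i) The center of `φ₁` lies in `Sing(X)`. (ii) `X₁` is a semi-stable curve over
  `S`, smooth over `S ∖ D`. (iii) `Sing(X₁)` has codimension at least three in `X₁`." No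
  sections, no boundary.
* PROVED, **EGA IV₄ 17.5.8 (iii) for schemes** (`isRegularLocalRing_stalk_of_smooth`): for a
  smooth `f : X → Y` with `Y` locally Noetherian, `𝒪_{X,x}` is regular if `𝒪_{Y,f(x)}` is — the
  affine rendering `Grothendieck1967_17_5_8_holds` (`SmoothUniformizationProofs.lean`) moved to
  stalks (`mem_regularLocus_fromSpec_iff`, `IsAffineOpen.comap_primeIdealOf_appLE`); whence the
  remark of 3.1, "the singular locus `Sing(X)` of the scheme `X` is contained in `Sing(f)`", for
  Situation 4.23 (`DeJong1996.SemiStablePair.isRegularLocalRing_of_smooth`: the points of an open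
  on which `f` is smooth are regular points of `X`).
* PROVED, **the parenthesis of 4.24** ("Of course the sections `τᵢ` still map into the smooth
  locus of `f`"): a morphism `σ : Y → X` into an open `U` over which `φ₁` is an isomorphism
  lifts (`DeJong1996.liftSection`, `Y → U ≅ φ₁⁻¹(U) ⊆ X₁`), the lift has image `φ₁⁻¹(σ(Y))`;
  for a pair in Situation 4.23 and a modification `φ₁` which is an isomorphism over opens
  `Uᵢ ⊇ τᵢ(Y)` on which `f` is smooth, with `φ₁ ≫ f` semi-stable smooth over `Y ∖ D` and `X₁`
  projective, the lifted data are again in Situation 4.23 with boundary `φ₁⁻¹(Z)`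
  (`DeJong1996.SemiStablePair.exists_lift`).
* PROVED: `DeJong1996SemiStableCodimThree.of_lemma32 : DeJong1996Lemma32 → DeJong1996SemiStableCodimThree`.

## Sources

* A. J. de Jong, *Smoothness, semi-stability and alterations*, Publ. Math. IHÉS 83 (1996) 51–93:
  2.17, 2.20 (pp. 60–61), 3.1 and Lemma 3.2 (p. 62), 3.3–3.4 (pp. 63–64), 4.23–4.24 (p. 75).
* A. Grothendieck, J. Dieudonné, *EGA IV₄*, Publ. Math. IHÉS 32 (1967), Prop. 17.5.8 (iii)
  (PDF p. 69).
* A. Grothendieck, J. Dieudonné, *EGA II*, 5.5.5 (ii) (compositions of projective morphisms to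
  a quasi-compact base are projective), for "projective modification of a projective variety".
-/

noncomputable section

open CategoryTheory CategoryTheory.Limits AlgebraicGeometry TopologicalSpace Topology

namespace Literature.AlgebraicGeometry.Resolution

universe u

/-! ## EGA IV₄ 17.5.8 (iii): smooth over regular is regular -/

/-- **EGA IV₄, Prop. 17.5.8 (iii), for schemes**: "Soient `Y` un préschéma localement
noethérien, `f : X → Y` un morphisme localement de type fini, lisse en un point `x ∈ X`; posons
`y = f(x)`. Alors … En particulier, pour que `𝒪_{X,x}` soit régulier, il faut et il suffit que
`𝒪_{Y,y}` le soit." The sufficiency, for `f` smooth: if `𝒪_{Y,f(x)}` is a regular local ring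
then so is `𝒪_{X,x}`. Proof: on affine neighbourhoods `V ∋ x`, `U ∋ f(x)` with `f(V) ⊆ U` the
ring map `Γ(Y, U) → Γ(X, V)` is smooth, the stalks are the localizations at the corresponding
primes `𝔮` and `𝔮 ∩ Γ(Y, U)`, and the affine statement is `Grothendieck1967_17_5_8_holds`.
[cite: Grothendieck1967, Prop. 17.5.8 (iii) (PDF p. 69)] -/
theorem isRegularLocalRing_stalk_of_smooth {X Y : Scheme.{u}} (f : X ⟶ Y) [Smooth f]
    [IsLocallyNoetherian Y] (x : X) (hy : IsRegularLocalRing (Y.presheaf.stalk (f x))) :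
    IsRegularLocalRing (X.presheaf.stalk x) := by
  obtain ⟨U, hU, hfxU, -⟩ :=
    exists_isAffineOpen_mem_and_subset (X := Y) (x := f x) (U := ⊤) trivial
  obtain ⟨V, hV, hxV, hVU⟩ :=
    exists_isAffineOpen_mem_and_subset (X := X) (x := x) (U := f ⁻¹ᵁ U) hfxU
  have hsm : (f.appLE U V hVU).hom.Smooth := f.smooth_appLE hU hV hVU
  letI : Algebra Γ(Y, U) Γ(X, V) := (f.appLE U V hVU).hom.toAlgebra
  haveI : Algebra.Smooth Γ(Y, U) Γ(X, V) := hsm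
  haveI : IsNoetherianRing Γ(Y, U) := IsLocallyNoetherian.component_noetherian ⟨U, hU⟩
  set q : PrimeSpectrum Γ(X, V) := hV.primeIdealOf ⟨x, hxV⟩ with hqdef
  have hsmAt : Algebra.IsSmoothAt Γ(Y, U) q.asIdeal := by
    have h : q ∈ Algebra.smoothLocus Γ(Y, U) Γ(X, V) := by
      rw [Algebra.smoothLocus_eq_univ]
      trivial
    exact h
  have key := Grothendieck1967_17_5_8_holds Γ(Y, U) Γ(X, V) inferInstance q.asIdeal hsmAt
  -- the point `f x` is `fromSpec (𝔮 ∩ Γ(Y, U))`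
  have hfx : hU.fromSpec (q.comap (f.appLE U V hVU).hom) = f x := by
    rw [IsAffineOpen.comap_primeIdealOf_appLE U hU V hV hVU hxV, hU.fromSpec_primeIdealOf]
  have hy' : IsRegularLocalRing
      (Localization.AtPrime (q.asIdeal.comap (algebraMap Γ(Y, U) Γ(X, V)))) := by
    have h1 : hU.fromSpec (q.comap (f.appLE U V hVU).hom) ∈ Scheme.regularLocus Y := by
      rw [hfx]
      exact hy
    rw [mem_regularLocus_fromSpec_iff, mem_regularLocus] at h1
    exact h1
  -- the point `x` is `fromSpec 𝔮`
  have h2 : hV.fromSpec q ∈ Scheme.regularLocus X := by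
    rw [mem_regularLocus_fromSpec_iff, mem_regularLocus]
    exact key.mpr hy'
  rw [hqdef, hV.fromSpec_primeIdealOf] at h2
  exact h2

/-- A smooth scheme over a regular locally Noetherian scheme is regular (EGA IV₄ 17.5.8 (iii)).
[cite: Grothendieck1967, Prop. 17.5.8 (iii) (PDF p. 69)] -/
theorem Scheme.IsRegular.of_smooth {X Y : Scheme.{u}} (f : X ⟶ Y) [Smooth f]
    [IsLocallyNoetherian Y] (hY : Scheme.IsRegular Y) : Scheme.IsRegular X :=
  fun x => isRegularLocalRing_stalk_of_smooth f x (hY (f x))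

namespace DeJong1996

namespace SemiStablePair

variable {k : Type u} [Field k] {X Y : Scheme.{u}} {f : X ⟶ Y} {g : Y ⟶ Spec (.of k)}
  {D : Set Y} {n : ℕ} {τ : Fin n → (Y ⟶ X)}

/-- In Situation 4.23 the base `Y` is Noetherian (projective over a field). [folklore] -/
theorem isNoetherian_base (hS : SemiStablePair f g D τ) : IsNoetherian Y :=
  isNoetherian_of_isProjectiveOver g hS.isProjectiveOver_base

/-- **de Jong 1996, 3.1: "the singular locus `Sing(X)` of the scheme `X` is contained in
`Sing(f)`"**, for Situation 4.23: the points of an open `U ⊆ X` on which `f` is smooth are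
regular points of `X` (`Y` being regular, EGA IV₄ 17.5.8 (iii)). [cite: DeJong1996, 3.1, p. 62] -/
theorem isRegularLocalRing_of_smooth (hS : SemiStablePair f g D τ) {U : X.Opens}
    (hU : Smooth (U.ι ≫ f)) {x : X} (hx : x ∈ U) : IsRegularLocalRing (X.presheaf.stalk x) := by
  haveI := hS.isNoetherian_base
  haveI : IsRegularLocalRing ((U : Scheme.{u}).presheaf.stalk ⟨x, hx⟩) :=
    isRegularLocalRing_stalk_of_smooth (U.ι ≫ f) ⟨x, hx⟩ (hS.isRegular_base _)
  exact IsRegularLocalRing.of_ringEquiv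
    (asIso (U.ι.stalkMap ⟨x, hx⟩)).commRingCatIsoToRingEquiv.symm

/-- In Situation 4.23 the sections `τᵢ` land in the regular locus of `X`.
[cite: DeJong1996, 3.1, p. 62] -/
theorem isRegularLocalRing_stalk_apply (hS : SemiStablePair f g D τ) (i : Fin n) (y : Y) :
    IsRegularLocalRing (X.presheaf.stalk (τ i y)) := by
  obtain ⟨U, hU, hUf⟩ := hS.exists_smooth i
  exact hS.isRegularLocalRing_of_smooth hUf (hU ⟨y, rfl⟩)

end SemiStablePair

/-! ## Lifting the sections through a modification which is an isomorphism near them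
(4.24: "Of course the sections `τᵢ` still map into the smooth locus of `f`") -/

section LiftSection

variable {X X₁ Y : Scheme.{u}}

/-- The lift of a morphism `σ : Y → X` landing in an open `U ⊆ X` over which `φ₁ : X₁ → X` is
an isomorphism: `Y → U ≅ φ₁⁻¹(U) ⊆ X₁`. [folklore] -/
def liftSection (σ : Y ⟶ X) (U : X.Opens) (hσ : Set.range σ ⊆ (U : Set X)) (φ₁ : X₁ ⟶ X)
    [IsIso (φ₁ ∣_ U)] : Y ⟶ X₁ :=
  IsOpenImmersion.lift U.ι σ (by rwa [Scheme.Opens.range_ι]) ≫ inv (φ₁ ∣_ U) ≫ (φ₁ ⁻¹ᵁ U).ι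

variable (σ : Y ⟶ X) (U : X.Opens) (hσ : Set.range σ ⊆ (U : Set X)) (φ₁ : X₁ ⟶ X)
  [IsIso (φ₁ ∣_ U)]

/-- The lift is a lift: `liftSection σ U hσ φ₁ ≫ φ₁ = σ`. [folklore] -/
@[reassoc (attr := simp)]
theorem liftSection_comp : liftSection σ U hσ φ₁ ≫ φ₁ = σ := by
  simp only [liftSection, Category.assoc]
  rw [← morphismRestrict_ι, IsIso.inv_hom_id_assoc, IsOpenImmersion.lift_fac]

/-- Pointwise form of `liftSection_comp`. [folklore] -/
theorem apply_liftSection_apply (y : Y) : φ₁ (liftSection σ U hσ φ₁ y) = σ y := by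
  have h := congrArg (fun ψ : Y ⟶ X => ψ y) (liftSection_comp σ U hσ φ₁)
  simpa only [Scheme.Hom.comp_apply] using h

/-- The lift lands in `φ₁⁻¹(U)`. [folklore] -/
theorem range_liftSection_subset :
    Set.range (liftSection σ U hσ φ₁) ⊆ ((φ₁ ⁻¹ᵁ U : X₁.Opens) : Set X₁) := by
  rintro _ ⟨y, rfl⟩
  have h : liftSection σ U hσ φ₁ y ∈ Set.range (φ₁ ⁻¹ᵁ U).ι := by
    simp only [liftSection, Scheme.Hom.comp_apply]
    exact Set.mem_range_self _
  rwa [Scheme.Opens.range_ι] at h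

/-- The image of the lift is the full preimage of the image: `φ₁` is injective over `U`.
[folklore] -/
theorem preimage_range_eq_range_liftSection :
    φ₁ ⁻¹' Set.range σ = Set.range (liftSection σ U hσ φ₁) := by
  refine Set.Subset.antisymm ?_ ?_
  · rintro x₁ ⟨y, hy⟩
    have hx₁U : x₁ ∈ (φ₁ ⁻¹ᵁ U : X₁.Opens) := by
      show φ₁ x₁ ∈ U
      rw [← hy]
      exact hσ ⟨y, rfl⟩
    have hx₁'U : liftSection σ U hσ φ₁ y ∈ (φ₁ ⁻¹ᵁ U : X₁.Opens) :=
      range_liftSection_subset σ U hσ φ₁ ⟨y, rfl⟩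
    have heq : (φ₁ ∣_ U) ⟨x₁, hx₁U⟩ = (φ₁ ∣_ U) ⟨liftSection σ U hσ φ₁ y, hx₁'U⟩ := by
      apply Subtype.ext
      rw [morphismRestrict_base_coe, morphismRestrict_base_coe]
      change φ₁ x₁ = φ₁ (liftSection σ U hσ φ₁ y)
      rw [apply_liftSection_apply, hy]
    have hinj := congrArg Subtype.val ((φ₁ ∣_ U).isOpenEmbedding.injective heq)
    exact ⟨y, hinj.symm⟩
  · rintro _ ⟨y, rfl⟩
    show φ₁ (liftSection σ U hσ φ₁ y) ∈ Set.range σ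
    rw [apply_liftSection_apply]
    exact ⟨y, rfl⟩

/-- `f` is smooth on `φ₁⁻¹(U)` along `φ₁ ≫ f` if it is smooth on `U`: `φ₁⁻¹(U) ≅ U → Y`.
[folklore] -/
theorem smooth_ι_comp_comp {f : X ⟶ Y} (hU : Smooth (U.ι ≫ f)) :
    Smooth ((φ₁ ⁻¹ᵁ U).ι ≫ φ₁ ≫ f) := by
  rw [← Category.assoc, ← morphismRestrict_ι, Category.assoc]
  infer_instance

end LiftSection

namespace SemiStablePair

variable {k : Type u} [Field k] {X X₁ Y : Scheme.{u}} {f : X ⟶ Y} {g : Y ⟶ Spec (.of k)}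
  {D : Set Y} {n : ℕ} {τ : Fin n → (Y ⟶ X)} {φ₁ : X₁ ⟶ X}

/-- **de Jong 1996, 4.24, first sentence: Situation 4.23 is preserved by a modification which
is an isomorphism near the sections.** If `(f, g, D, τ)` is in Situation 4.23, `X₁` is
integral and projective over `k`, `φ₁ : X₁ → X` is an isomorphism over opens `Uᵢ ⊇ τᵢ(Y)` on
which `f` is smooth, and `φ₁ ≫ f` is a semi-stable curve smooth over `Y ∖ D`, then the sections
lift to `τ₁ᵢ : Y → X₁` (`τ₁ᵢ ≫ φ₁ = τᵢ`; "Of course the sections `τᵢ` still map into the smooth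
locus of `f`"), `(φ₁ ≫ f, g, D, τ₁)` is again in Situation 4.23, and its boundary is
`⋃ᵢ τ₁ᵢ(Y) ∪ (φ₁ ≫ f)⁻¹(D) = φ₁⁻¹(Z)`. [cite: DeJong1996, 4.24, p. 75] -/
theorem exists_lift (hS : SemiStablePair f g D τ) [IsIntegral X₁]
    (hproj : Literature.AlgebraicGeometry.Motives.IsProjectiveOver (Over.mk (φ₁ ≫ f ≫ g)))
    (hiso : ∀ i, ∃ U : X.Opens, Set.range (τ i) ⊆ (U : Set X) ∧ Smooth (U.ι ≫ f) ∧
      IsIso (φ₁ ∣_ U))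
    (hss : IsSemiStableCurve (φ₁ ≫ f))
    (hsm : Smooth ((φ₁ ≫ f) ∣_ ⟨Dᶜ, hS.isStrictNormalCrossingsDivisor.isClosed.isOpen_compl⟩)) :
    ∃ τ₁ : Fin n → (Y ⟶ X₁), (∀ i, τ₁ i ≫ φ₁ = τ i) ∧ SemiStablePair (φ₁ ≫ f) g D τ₁ ∧
      φ₁ ⁻¹' semiStableBoundary f D τ = semiStableBoundary (φ₁ ≫ f) D τ₁ := by
  choose U hU hUf hUiso using hiso
  haveI : ∀ i, IsIso (φ₁ ∣_ U i) := hUiso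
  have hrange : ∀ i, Set.range (liftSection (τ i) (U i) (hU i) φ₁) = φ₁ ⁻¹' Set.range (τ i) :=
    fun i => (preimage_range_eq_range_liftSection (τ i) (U i) (hU i) φ₁).symm
  refine ⟨fun i => liftSection (τ i) (U i) (hU i) φ₁, fun i => liftSection_comp _ _ _ _, ?_, ?_⟩
  · exact
      { isIntegral := ‹_›
        isProjectiveOver := by rwa [Category.assoc]
        isIntegral_base := hS.isIntegral_base
        isProjectiveOver_base := hS.isProjectiveOver_base
        isRegular_base := hS.isRegular_base
        isStrictNormalCrossingsDivisor := hS.isStrictNormalCrossingsDivisor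
        isSemiStableCurve := hss
        smooth_morphismRestrict := hsm
        comp_eq_id := fun i => by rw [← Category.assoc, liftSection_comp, hS.comp_eq_id]
        pairwise_disjoint := fun i j hij => by
          change Disjoint (Set.range _) (Set.range _)
          rw [hrange i, hrange j]
          exact (hS.pairwise_disjoint hij).preimage φ₁
        exists_smooth := fun i =>
          ⟨φ₁ ⁻¹ᵁ U i, range_liftSection_subset _ _ _ _, smooth_ι_comp_comp (U i) φ₁ (hUf i)⟩ }
  · ext x
    simp only [mem_semiStableBoundary_iff, Set.mem_preimage, Scheme.Hom.comp_apply]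
    refine or_congr_left (exists_congr fun i => ?_)
    rw [hrange i, Set.mem_preimage]

end SemiStablePair

end DeJong1996

/-! ## Lemma 3.2 as printed -/

/-- NAMED FACT — **de Jong 1996, Lemma 3.2**, for the semi-stable curve of Situation 4.23.
"3.1. Let `S` be an excellent regular scheme and let `D ⊂ S` be a divisor with strict normal
crossings. … Assume we have a semi-stable curve `f : X → S` smooth over `S ∖ D`. … 3.2. Lemma. —
There exists a projective modification `φ₁ : X₁ → X` with the following properties: (i) The
center of `φ₁` lies in `Sing(X)`. (ii) `X₁` is a semi-stable curve over `S`, smooth over `S ∖ D`.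
(iii) `Sing(X₁)` has codimension at least three in `X₁`. (iv) If the curve `X` is split
semi-stable (2.22), then the curve `X₁` is split semi-stable over `S`." Rendered for the data of
Situation 4.23 (`DeJong1996.SemiStablePair f g D τ` over an algebraically closed field `k`; the
base `S = Y`, a nonsingular projective variety, is an excellent regular scheme; the sections `τ`
play no role): there is a modification `φ₁ : X₁ → X` (`IsModification`, 2.17: `X₁` integral,
`φ₁` proper birational) with `X₁` projective over `k` ("projective modification" of the
projective `X`; EGA II 5.5.5 (ii)) such that (i) `φ₁` is an isomorphism over every open of `X`
consisting of regular points (the centre, 2.17, "the closed subset of `S` over which `φ` is not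
an isomorphism", lies in `Sing(X)`); (ii) `φ₁ ≫ f` is a semi-stable curve (`IsSemiStableCurve`,
2.21), smooth over `Y ∖ D`; (iii) every non-regular point `x` of `X₁` has `dim 𝒪_{X₁,x} ≥ 3`
(for the variety `X₁`: `codim(Sing(X₁), X₁) ≥ 3`). (iv) is not rendered (4.24: "there we
consider only closed points, so that the situation is automatically split"). Proof in the
source: 3.3 (the complete local rings `A'⟦u, v⟧/(Q - t₁^{n₁} ⋯ t_r^{n_r})`, 2.23) and 3.4 (blow
up a codimension-2 component `T` of `Sing(X)`; the invariant `n_T` drops by 2; three charts).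
Users take `(h : DeJong1996Lemma32)`; it is the node carrying 2.23 and 3.3–3.4.
[cite: DeJong1996, Lemma 3.2, p. 62] -/
def DeJong1996Lemma32 : Prop :=
  ∀ (k : Type u) [Field k] [IsAlgClosed k] (X Y : Scheme.{u}) (f : X ⟶ Y)
    (g : Y ⟶ Spec (.of k)) (D : Set Y) (n : ℕ) (τ : Fin n → (Y ⟶ X))
    (hS : DeJong1996.SemiStablePair f g D τ),
    ∃ (X₁ : Scheme.{u}) (φ₁ : X₁ ⟶ X), IsModification φ₁ ∧
      Literature.AlgebraicGeometry.Motives.IsProjectiveOver (Over.mk (φ₁ ≫ f ≫ g)) ∧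
      (∀ U : X.Opens, (∀ x ∈ U, IsRegularLocalRing (X.presheaf.stalk x)) → IsIso (φ₁ ∣_ U)) ∧
      IsSemiStableCurve (φ₁ ≫ f) ∧
      Smooth ((φ₁ ≫ f) ∣_ ⟨Dᶜ, hS.isStrictNormalCrossingsDivisor.isClosed.isOpen_compl⟩) ∧
      ∀ x : X₁, ¬ IsRegularLocalRing (X₁.presheaf.stalk x) →
        (3 : WithBot ℕ∞) ≤ ringKrullDim (X₁.presheaf.stalk x)

/-- **de Jong 1996, 4.24, first sentence, from Lemma 3.2 as printed**: the named fact
`DeJong1996SemiStableCodimThree` of `AlterationsSemiStableResolution.lean` (Lemma 3.2 bundled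
with the lifted sections, Situation 4.23 for the new pair and the boundary `φ⁻¹(Z)`) follows
from `DeJong1996Lemma32`: the sections land in opens on which `f` is smooth, whose points are
regular (3.1, EGA IV₄ 17.5.8 (iii)), so the modification is an isomorphism over them and the
sections lift (`DeJong1996.SemiStablePair.exists_lift`). [cite: DeJong1996, 4.24, p. 75] -/
theorem DeJong1996SemiStableCodimThree.of_lemma32 (h : DeJong1996Lemma32.{u}) :
    DeJong1996SemiStableCodimThree.{u} := by
  intro k _ _ X Y f g D n τ hS
  obtain ⟨X₁, φ₁, hφ, hproj, hiso, hss, hsm, hcodim⟩ := h k X Y f g D n τ hS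
  haveI := hφ.isIntegral
  have hiso' : ∀ i, ∃ U : X.Opens, Set.range (τ i) ⊆ (U : Set X) ∧ Smooth (U.ι ≫ f) ∧
      IsIso (φ₁ ∣_ U) := fun i => by
    obtain ⟨U, hU, hUf⟩ := hS.exists_smooth i
    exact ⟨U, hU, hUf, hiso U fun x hx => hS.isRegularLocalRing_of_smooth hUf hx⟩
  obtain ⟨τ₁, hτ₁, hS₁, hZ⟩ := hS.exists_lift hproj hiso' hss hsm
  exact ⟨X₁, φ₁, τ₁, hφ, hiso, hτ₁, hS₁, hZ, hcodim⟩

/-- Sanity (non-vacuity of the shape of Lemma 3.2): for a pair in Situation 4.23 whose total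
space is already nonsingular, Lemma 3.2 holds with `φ₁ = 𝟙` — no blow-up is needed. [folklore] -/
theorem DeJong1996.SemiStablePair.lemma32_of_isRegular {k : Type u} [Field k]
    {X Y : Scheme.{u}} {f : X ⟶ Y} {g : Y ⟶ Spec (.of k)} {D : Set Y} {n : ℕ}
    {τ : Fin n → (Y ⟶ X)} (hS : DeJong1996.SemiStablePair f g D τ) (hreg : Scheme.IsRegular X) :
    ∃ (X₁ : Scheme.{u}) (φ₁ : X₁ ⟶ X), IsModification φ₁ ∧
      Literature.AlgebraicGeometry.Motives.IsProjectiveOver (Over.mk (φ₁ ≫ f ≫ g)) ∧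
      (∀ U : X.Opens, (∀ x ∈ U, IsRegularLocalRing (X.presheaf.stalk x)) → IsIso (φ₁ ∣_ U)) ∧
      IsSemiStableCurve (φ₁ ≫ f) ∧
      Smooth ((φ₁ ≫ f) ∣_ ⟨Dᶜ, hS.isStrictNormalCrossingsDivisor.isClosed.isOpen_compl⟩) ∧
      ∀ x : X₁, ¬ IsRegularLocalRing (X₁.presheaf.stalk x) →
        (3 : WithBot ℕ∞) ≤ ringKrullDim (X₁.presheaf.stalk x) := by
  haveI := hS.isIntegral
  have hid : ∀ U : X.Opens, IsIso (𝟙 X ∣_ U) := fun U =>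
    (MorphismProperty.isomorphisms.iff _).mp
      (IsZariskiLocalAtTarget.restrict (P := MorphismProperty.isomorphisms Scheme)
        ((MorphismProperty.isomorphisms.iff _).mpr inferInstance) U)
  refine ⟨X, 𝟙 X, ⟨inferInstance, inferInstance, ⊤, by simp, by simp, hid ⊤⟩, ?_,
    fun U _ => hid U, ?_, ?_, fun x hx => (hx (hreg x)).elim⟩
  · simpa only [Category.id_comp] using hS.isProjectiveOver
  · simpa only [Category.id_comp] using hS.isSemiStableCurve
  · rw [Category.id_comp]
    exact hS.smooth_morphismRestrict

end Literature.AlgebraicGeometry.Resolution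

end
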